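import Literature.Geometry.Lorentzian.TimeSeparationPrefix
import Mathlib.MeasureTheory.Group.MeasurableEquiv
import HarnessLib

/-!
# The reverse triangle inequality for the time separation (O'Neill 1983, Lemma 14.16 (2))

For a `Cⁿ` (`n ≥ 1`) time-oriented Lorentzian metric on a manifold without boundary we prove
O'Neill's reverse triangle inequality (Ch. 14, Lemma 14.16 (2), p. 409: "If `p ≤ q ≤ r`, then
`τ(p, q) + τ(q, r) ≤ τ(p, r)`") for the time separation `LorentzianMetric.lorentzDist` of
`Literature.Geometry.Lorentzian.LorentzianDistance`, in three forms:

* `LorentzianMetric.arcLength_add_arcLength_le_lorentzDist` — for consecutive future causal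
  segments `γ₁ : [a₁, b₁] → M` from `p` to `q` and `γ₂ : [a₂, b₂] → M` from `q` to `r`,
  `L(γ₁) + L(γ₂) ≤ τ(p, r)`;
* `LorentzianMetric.arcLength_add_lorentzDist_le` — `L(γ₁) + τ(q, r) ≤ τ(p, r)` for `r ∈ J⁺(q)`;
* `LorentzianMetric.lorentzDist_add_lorentzDist_le` — `τ(p, q) + τ(q, r) ≤ τ(p, r)` for
  `q ∈ J⁺(p)`, `r ∈ J⁺(q)`.

O'Neill's causal curves are piecewise smooth, so for him `α + β` is a causal curve and the
inequality is the definition of `τ` as a supremum. The tree's causal curves are differentiable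
everywhere, so the corner of the concatenation has to be rounded off; the technical core is
`exists_isFutureCausalCurveOn_trans_head_tail`, the construction of
`TimeSeparationPrefix.exists_isFutureCausalCurveOn_trans_tail` with both by-products exported
(the glued curve contains an affine reparametrisation of `γ₁|[a₁, b₁ - η]` and a translate of
`γ₂|[a₂ + η, b₂]`), together with the invariance of arc length under affine reparametrisation
(`PseudoRiemannianMetric.arcLength_comp_mul`, `arcLength_comp_mul_add`: change of variables in
the lower Lebesgue integral, no measurability needed) and exhaustion of the arc length from the
inside at the right end (`arcLength_le_of_forall_gt`). Letting `η → 0` gives the inequality.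
Everything is proved; no definitions and no named facts are introduced (D-0026).

## References

* B. O'Neill, *Semi-Riemannian geometry with applications to relativity*, Academic Press 1983,
  Ch. 14, Def. 14.15 and Lemma 14.16 (2) (p. 409), p. 402; Ch. 10, Prop. 10.46; Ch. 5,
  Def. 5.11, Lemma 5.12 (arc length and reparametrisation). [ONeillSemiRiemannian1983]
-/

noncomputable section

open Bundle Set Filter Function MeasureTheory
open scoped Manifold ContDiff Topology ENNReal

namespace Literature.Geometry.Lorentzian

variable {E : Type*} [NormedAddCommGroup E] [NormedSpace ℝ E] {H : Type*} [TopologicalSpace H]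
  {I : ModelWithCorners ℝ E H} {n : ℕ∞ω} {M : Type*} [TopologicalSpace M] [ChartedSpace H M]
  [IsManifold I ∞ M]

/-! ### Gluing with head and tail kept -/

namespace LorentzianMetric

variable {g : LorentzianMetric I n M} {τ : TimeOrientation g}

/-- **Concatenation of causal curves with rounded corner, keeping the head of the first and the
tail of the second curve.** The construction of `exists_isFutureCausalCurveOn_trans_tail`
(`Literature.Geometry.Lorentzian.TimeSeparationPrefix`; O'Neill 1983, Ch. 14, p. 402 with the
corner rounded off, Ch. 10, Prop. 10.46), with BOTH by-products exported: given `η > 0`, the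
resulting future causal curve `γ : [a, b] → M` from `γ₁ a₁` to `γ₂ b₂` coincides on an initial
parameter interval `[a, s₁]` with the affine reparametrisation `s ↦ γ₁ (k s + b₁)` (`k > 0`;
`k = 1` unless the velocities at the junction are proportional), covering `γ₁|[a₁, b₁ - η]`
(`k a + b₁ = a₁`, `b₁ - η ≤ k s₁ + b₁`), and on a final interval `(s₀, b]`, `s₁ ≤ s₀`, with the
translate `γ₂ (· + c)` covering `γ₂|[a₂ + η, b₂]`. The proof is that of
`exists_isFutureCausalCurveOn_trans_tail`, followed line by line.
[cite: ONeillSemiRiemannian1983, Ch. 14, p. 402 and Ch. 10, Prop. 10.46] -/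
theorem exists_isFutureCausalCurveOn_trans_head_tail [BoundarylessManifold I M] (hn : 1 ≤ n)
    {γ₁ γ₂ : ℝ → M} {a₁ b₁ a₂ b₂ : ℝ} (hab₁ : a₁ < b₁) (hab₂ : a₂ < b₂)
    (hγ₁ : g.IsFutureCausalCurveOn τ γ₁ (Icc a₁ b₁))
    (hγ₂ : g.IsFutureCausalCurveOn τ γ₂ (Icc a₂ b₂))
    (hjoin : γ₁ b₁ = γ₂ a₂) {η : ℝ} (hη : 0 < η) :
    ∃ (γ : ℝ → M) (a b s₁ s₀ c k : ℝ), a < b ∧ g.IsFutureCausalCurveOn τ γ (Icc a b) ∧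
      γ a = γ₁ a₁ ∧ γ b = γ₂ b₂ ∧ a ≤ s₁ ∧ s₁ ≤ s₀ ∧ s₀ < b ∧ 0 < k ∧ k * a + b₁ = a₁ ∧
      b₁ - η ≤ k * s₁ + b₁ ∧ (∀ s ∈ Icc a s₁, γ s = γ₁ (k * s + b₁)) ∧
      b + c = b₂ ∧ s₀ + c ≤ a₂ + η ∧ ∀ s ∈ Ioc s₀ b, γ s = γ₂ (s + c) := by
  -- the junction point and its chart
  set p : M := γ₁ b₁ with hpdef
  set φ := extChartAt I p with hφ
  set x₀ : E := φ p with hx₀def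
  have hps : p ∈ (chartAt H p).source := mem_chart_source H p
  have hx₀t : x₀ ∈ φ.target := (extChartAt I p).map_source (mem_extChartAt_source p)
  have hx₀p : φ.symm x₀ = p := (extChartAt I p).left_inv (mem_extChartAt_source p)
  -- a ball of the model space inside the chart target (no boundary)
  obtain ⟨R, hR, hballR⟩ : ∃ R : ℝ, 0 < R ∧ Metric.ball x₀ R ⊆ φ.target := by
    have hint : x₀ ∈ interior φ.target :=
      ModelWithCorners.isInteriorPoint_iff.mp (BoundarylessManifold.isInteriorPoint (I := I))
    exact Metric.mem_nhds_iff.mp (mem_interior_iff_mem_nhds.mp hint)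
  have hballR' : ∀ x : E, ‖x - x₀‖ < R → x ∈ φ.target :=
    fun x hx ↦ hballR (by rwa [Metric.mem_ball, dist_eq_norm])
  have htn : ∀ x : E, ‖x - x₀‖ < R → φ.target ∈ 𝓝 x := fun x hx ↦
    Filter.mem_of_superset (Metric.isOpen_ball.mem_nhds (by rwa [Metric.mem_ball, dist_eq_norm]))
      hballR
  -- the metric and the time orientation in coordinates
  set G : E → E →L[ℝ] E →L[ℝ] ℝ := g.coordMetric p with hGdef
  set Tc : E → E := τ.coordTime p with hTcdef
  have hGcd : ContDiffOn ℝ 1 G φ.target := g.contDiffOn_coordMetric hn p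
  have hGd : ∀ x, ‖x - x₀‖ < R → DifferentiableAt ℝ G x := fun x hx ↦
    ((hGcd.differentiableOn one_ne_zero) x (hballR' x hx)).differentiableAt (htn x hx)
  have hTc : ∀ x, ‖x - x₀‖ < R → ContinuousAt (fun x ↦ G x (Tc x)) x := fun x hx ↦
    ((hGcd.continuousOn.clm_apply (τ.continuousOn_coordTime hn p)) x (hballR' x hx)).continuousAt
      (htn x hx)
  have hsymm : ∀ x, ‖x - x₀‖ < R → ∀ v w, G x v w = G x w v :=
    fun x hx v w ↦ g.coordMetric_comm (hballR' x hx) v w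
  -- the timecone inequality, transported to coordinates
  have hcone : ∀ x, ‖x - x₀‖ < R → ∀ v w, G x v v ≤ 0 → v ≠ 0 → G x (Tc x) v < 0 →
      G x w w < 0 → G x (Tc x) w < 0 → G x v w < 0 := by
    intro x hx v w hvv hv0 hvf hww hwf
    have hxt := hballR' x hx
    have hw0 : w ≠ 0 := fun h ↦ by rw [h, map_zero] at hwf; exact lt_irrefl 0 hwf
    have hv : τ.IsFutureDirected _ :=
      (isFutureDirected_symmL_iff (τ := τ) hxt v).mpr ⟨⟨hvv, hv0⟩, hvf⟩
    have hw : τ.IsFutureDirected _ :=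
      (isFutureDirected_symmL_iff (τ := τ) hxt w).mpr ⟨⟨hww.le, hw0⟩, hwf⟩
    have hwt : g.IsTimelike _ := (isTimelike_symmL_iff (g := g) hxt w).mpr hww
    have key := hw.val_lt_zero τ hwt hv
    rw [g.symm] at key
    rwa [← g.coordMetric_apply hxt v w] at key
  -- a neighbourhood of the junction which the chart maps into the ball
  set N : Set M := φ.source ∩ φ ⁻¹' Metric.ball x₀ R with hNdef
  have hN : N ∈ 𝓝 p := Filter.inter_mem (extChartAt_source_mem_nhds p)
    ((continuousAt_extChartAt p).preimage_mem_nhds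
      (Metric.isOpen_ball.mem_nhds (Metric.mem_ball_self hR)))
  have hNs : ∀ y ∈ N, y ∈ (chartAt H p).source := fun y hy ↦ by
    rw [← extChartAt_source I p]; exact hy.1
  have hNb : ∀ y ∈ N, ‖φ y - x₀‖ < R := fun y hy ↦ by
    have := hy.2; rwa [mem_preimage, Metric.mem_ball, dist_eq_norm] at this
  -- continuity of `γ₁` at `b₁` and of `γ₂` at `a₂`
  have hc₁b : ContinuousAt γ₁ b₁ := (hγ₁ b₁ ⟨hab₁.le, le_rfl⟩).1.continuousAt
  have hc₂a : ContinuousAt γ₂ a₂ := (hγ₂ a₂ ⟨le_rfl, hab₂.le⟩).1.continuousAt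
  obtain ⟨d₁, hd₁, hd₁N⟩ : ∃ d : ℝ, 0 < d ∧ ∀ t, |t - b₁| < d → γ₁ t ∈ N := by
    have := hc₁b.preimage_mem_nhds hN
    rw [Metric.mem_nhds_iff] at this
    obtain ⟨d, hd, h⟩ := this
    exact ⟨d, hd, fun t ht ↦ h (by rwa [Metric.mem_ball, Real.dist_eq])⟩
  obtain ⟨d₂, hd₂, hd₂N⟩ : ∃ d : ℝ, 0 < d ∧ ∀ t, |t - a₂| < d → γ₂ t ∈ N := by
    have hN' : N ∈ 𝓝 (γ₂ a₂) := by rwa [← hjoin]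
    have := hc₂a.preimage_mem_nhds hN'
    rw [Metric.mem_nhds_iff] at this
    obtain ⟨d, hd, h⟩ := this
    exact ⟨d, hd, fun t ht ↦ h (by rwa [Metric.mem_ball, Real.dist_eq])⟩
  -- the scale `δ₀`
  obtain ⟨δ₀, hδ₀, hδ₀1, hδ₀2, hδ₀3, hδ₀4⟩ : ∃ δ : ℝ, 0 < δ ∧ 2 * δ ≤ d₁ ∧ 2 * δ ≤ d₂ ∧
      2 * δ ≤ b₁ - a₁ ∧ 2 * δ ≤ b₂ - a₂ := by
    refine ⟨min (min (d₁ / 2) (d₂ / 2)) (min ((b₁ - a₁) / 2) ((b₂ - a₂) / 2)),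
      lt_min (lt_min (by positivity) (by positivity)) (lt_min (by linarith) (by linarith)),
      ?_, ?_, ?_, ?_⟩
    · have := (min_le_left _ _).trans (min_le_left (d₁ / 2) (d₂ / 2))
        (a := min (min (d₁ / 2) (d₂ / 2)) (min ((b₁ - a₁) / 2) ((b₂ - a₂) / 2)))
      linarith
    · have := (min_le_left _ _).trans (min_le_right (d₁ / 2) (d₂ / 2))
        (a := min (min (d₁ / 2) (d₂ / 2)) (min ((b₁ - a₁) / 2) ((b₂ - a₂) / 2)))
      linarith
    · have := (min_le_right _ _).trans (min_le_left ((b₁ - a₁) / 2) ((b₂ - a₂) / 2))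
        (a := min (min (d₁ / 2) (d₂ / 2)) (min ((b₁ - a₁) / 2) ((b₂ - a₂) / 2)))
      linarith
    · have := (min_le_right _ _).trans (min_le_right ((b₁ - a₁) / 2) ((b₂ - a₂) / 2))
        (a := min (min (d₁ / 2) (d₂ / 2)) (min ((b₁ - a₁) / 2) ((b₂ - a₂) / 2)))
      linarith
  have hγ₁N : ∀ s, |s| < 2 * δ₀ → γ₁ (s + b₁) ∈ N := fun s hs ↦
    hd₁N _ (by rw [add_sub_cancel_right]; linarith)
  have hγ₂N : ∀ s, |s| < 2 * δ₀ → γ₂ (s + a₂) ∈ N := fun s hs ↦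
    hd₂N _ (by rw [add_sub_cancel_right]; linarith)
  -- the two curves in coordinates, parametrised so that the corner is at `0`
  set c₁ : ℝ → E := fun s ↦ φ (γ₁ (s + b₁)) with hc₁def
  set u₁ : ℝ → E := fun s ↦ (trivializationAt E (TangentSpace I) p).continuousLinearMapAt ℝ
    (γ₁ (s + b₁)) (velocity I γ₁ (s + b₁)) with hu₁def
  set c₂ : ℝ → E := fun s ↦ φ (γ₂ (s + a₂)) with hc₂def
  set u₂ : ℝ → E := fun s ↦ (trivializationAt E (TangentSpace I) p).continuousLinearMapAt ℝ
    (γ₂ (s + a₂)) (velocity I γ₂ (s + a₂)) with hu₂def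
  have hc₁ : ∀ s ∈ Icc (-δ₀) 0, HasDerivAt c₁ (u₁ s) s ∧ ‖c₁ s - x₀‖ < R ∧
      (G (c₁ s) (u₁ s) (u₁ s) ≤ 0 ∧ u₁ s ≠ 0) ∧ G (c₁ s) (Tc (c₁ s)) (u₁ s) < 0 := by
    intro s hs
    have hyN : γ₁ (s + b₁) ∈ N := hγ₁N s (by rw [abs_lt]; constructor <;> linarith [hs.1, hs.2])
    have hy := hNs _ hyN
    obtain ⟨hmd, hfd⟩ := hγ₁ (s + b₁) ⟨by linarith [hs.1], by linarith [hs.2]⟩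
    exact ⟨(hasDerivAt_extChartAt_comp_continuousLinearMapAt (p := p) hmd hy).comp_add_const s b₁,
      hNb _ hyN, (isFutureDirected_iff_coord hy _).mp hfd⟩
  have hc₂ : ∀ s ∈ Icc 0 δ₀, HasDerivAt c₂ (u₂ s) s ∧ ‖c₂ s - x₀‖ < R ∧
      (G (c₂ s) (u₂ s) (u₂ s) ≤ 0 ∧ u₂ s ≠ 0) ∧ G (c₂ s) (Tc (c₂ s)) (u₂ s) < 0 := by
    intro s hs
    have hyN : γ₂ (s + a₂) ∈ N := hγ₂N s (by rw [abs_lt]; constructor <;> linarith [hs.1, hs.2])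
    have hy := hNs _ hyN
    obtain ⟨hmd, hfd⟩ := hγ₂ (s + a₂) ⟨by linarith [hs.1], by linarith [hs.2]⟩
    exact ⟨(hasDerivAt_extChartAt_comp_continuousLinearMapAt (p := p) hmd hy).comp_add_const s a₂,
      hNb _ hyN, (isFutureDirected_iff_coord hy _).mp hfd⟩
  have h₁0 : c₁ 0 = x₀ := by simp [hc₁def, hx₀def, hpdef]
  have h₂0 : c₂ 0 = x₀ := by
    show φ (γ₂ (0 + a₂)) = φ p
    rw [zero_add, ← hjoin]
  -- the velocities at the corner, in coordinates and pulled back to `T_p M`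
  obtain ⟨-, -, ⟨hv₁c, hv₁0⟩, hv₁f⟩ := hc₁ 0 ⟨by linarith, le_rfl⟩
  obtain ⟨-, -, ⟨hv₂c, hv₂0⟩, hv₂f⟩ := hc₂ 0 ⟨le_rfl, hδ₀.le⟩
  rw [h₁0] at hv₁c hv₁f
  rw [h₂0] at hv₂c hv₂f
  set ψ := (trivializationAt E (TangentSpace I) p).symmL ℝ (φ.symm x₀) with hψ
  have hw₁ : τ.IsFutureDirected (ψ (u₁ 0)) :=
    (isFutureDirected_symmL_iff (τ := τ) hx₀t (u₁ 0)).mpr ⟨⟨hv₁c, hv₁0⟩, hv₁f⟩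
  have hw₂ : τ.IsFutureDirected (ψ (u₂ 0)) :=
    (isFutureDirected_symmL_iff (τ := τ) hx₀t (u₂ 0)).mpr ⟨⟨hv₂c, hv₂0⟩, hv₂f⟩
  -- the reparametrised first curve
  have hγ₁' : g.IsFutureCausalCurveOn τ (fun s ↦ γ₁ (s + b₁)) (Icc (a₁ - b₁) 0) := by
    have := hγ₁.comp_add_const b₁; rwa [sub_self] at this
  by_cases hpar : ∃ c : ℝ, 0 < c ∧ u₂ 0 = c • u₁ 0
  · /- **Proportional velocities**: reparametrise `γ₁` affinely so that the two velocities at the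
    junction agree; the concatenation is then differentiable at the junction and contains the
    translate of the whole of `γ₂`. -/
    obtain ⟨c, hc, hcu⟩ := hpar
    -- the coordinate curve through the junction: `c₁` rescaled by `c`, then `c₂`
    set ĉ : ℝ → E := CausalCurveGluing.glueAt 0 (fun s ↦ c₁ (c * s)) c₂ with hĉ
    have hĉd : HasDerivAt ĉ (u₂ 0) 0 := by
      refine CausalCurveGluing.hasDerivAt_glueAt ?_ (hc₂ 0 ⟨le_rfl, hδ₀.le⟩).1 ?_
      · have hd₁ : HasDerivAt c₁ (u₁ 0) (c * 0) := by
          rw [mul_zero]; exact (hc₁ 0 ⟨by linarith, le_rfl⟩).1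
        have h := hd₁.scomp (0 : ℝ) ((hasDerivAt_id (0 : ℝ)).const_mul c)
        refine h.congr_deriv ?_
        rw [hcu, mul_one]
      · simp only [mul_zero, h₁0, h₂0]
    have hm : g.IsFutureCausalCurveOn τ (φ.symm ∘ ĉ) (Icc 0 0) := by
      refine isFutureCausalCurveOn_extChartAt_symm_comp (U := Metric.ball x₀ R)
        Metric.isOpen_ball hballR (u := fun _ ↦ u₂ 0) fun s hs ↦ ?_
      have hs0 : s = 0 := le_antisymm hs.2 hs.1
      subst hs0
      have hĉ0 : ĉ 0 = x₀ := by
        rw [hĉ, CausalCurveGluing.glueAt_of_le le_rfl]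
        show c₁ (c * 0) = x₀
        rw [mul_zero, h₁0]
      refine ⟨hĉd, ?_, ?_⟩
      · rw [hĉ0]; exact Metric.mem_ball_self hR
      · rw [hĉ0]; exact ⟨⟨hv₂c, hv₂0⟩, hv₂f⟩
    -- the rescaled first curve
    have hγ₁'' : g.IsFutureCausalCurveOn τ (fun s ↦ γ₁ (b₁ + c * s)) (Icc ((a₁ - b₁) / c) 0) := by
      have h := hγ₁.comp_of_hasDerivAt (φ := fun s ↦ b₁ + c * s) (φ' := fun _ ↦ c)
        (fun u ↦ by simpa using ((hasDerivAt_id u).const_mul c).const_add b₁) (fun _ ↦ hc)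
      refine fun s hs ↦ h s ?_
      show b₁ + c * s ∈ Icc a₁ b₁
      have h1 : (a₁ - b₁) / c ≤ s := hs.1
      rw [div_le_iff₀ hc] at h1
      have h2 : c * s ≤ 0 := mul_nonpos_of_nonneg_of_nonpos hc.le hs.2
      rw [mul_comm] at h1
      exact ⟨by linarith, by linarith⟩
    -- the translated second curve
    have hγ₂'' : g.IsFutureCausalCurveOn τ (fun s ↦ γ₂ (s + a₂)) (Icc 0 (b₂ - a₂)) := by
      have := hγ₂.comp_add_const a₂; rwa [sub_self] at this
    -- glue
    set δM := min δ₀ (δ₀ / c) with hδM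
    have hδM0 : 0 < δM := lt_min hδ₀ (div_pos hδ₀ hc)
    have hΓ := IsFutureCausalCurveOn.glue (σ₀ := 0) (σ₁ := 0) le_rfl hδM0 hγ₁'' hm hγ₂''
      (fun s hs ↦ by
        have hsN : |c * s| < 2 * δ₀ := by
          have h1 : -δM < s := by linarith [hs.1]
          have h3 : δM ≤ δ₀ / c := min_le_right _ _
          have h4 : c * (δ₀ / c) = δ₀ := mul_div_cancel₀ δ₀ hc.ne'
          have h5 : c * (-δM) < c * s := mul_lt_mul_of_pos_left h1 hc
          have h6 : c * δM ≤ c * (δ₀ / c) := mul_le_mul_of_nonneg_left h3 hc.le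
          have h7 : c * s ≤ 0 := mul_nonpos_of_nonneg_of_nonpos hc.le hs.2
          rw [mul_neg] at h5
          rw [abs_lt]
          exact ⟨by linarith, by linarith⟩
        show φ.symm (ĉ s) = γ₁ (b₁ + c * s)
        rw [hĉ, CausalCurveGluing.glueAt_of_le hs.2, add_comm b₁]
        exact (extChartAt I p).left_inv (hγ₁N (c * s) hsN).1)
      (fun s hs ↦ by
        have hsN : |s| < 2 * δ₀ := by
          rw [abs_lt]; constructor <;> linarith [hs.1, hs.2, min_le_left δ₀ (δ₀ / c)]
        show φ.symm (ĉ s) = γ₂ (s + a₂)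
        rw [hĉ, CausalCurveGluing.glueAt_of_lt hs.1]
        exact (extChartAt I p).left_inv (hγ₂N s hsN).1)
    have hapos : (a₁ - b₁) / c < 0 := div_neg_of_neg_of_pos (by linarith) hc
    have hbpos : 0 < b₂ - a₂ := by linarith
    have hka : c * ((a₁ - b₁) / c) + b₁ = a₁ := by
      rw [mul_div_cancel₀ _ hc.ne', sub_add_cancel]
    refine ⟨_, (a₁ - b₁) / c, b₂ - a₂, 0, 0, a₂, c, by linarith, hΓ, ?_, ?_, hapos.le, le_rfl,
      hbpos, hc, hka, by linarith, ?_, by ring, by linarith, ?_⟩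
    · rw [CausalCurveGluing.glueAt_of_le hapos.le]
      show γ₁ (b₁ + c * ((a₁ - b₁) / c)) = γ₁ a₁
      congr 1; field_simp; ring
    · rw [CausalCurveGluing.glueAt_of_lt hbpos, CausalCurveGluing.glueAt_of_lt hbpos]
      show γ₂ (b₂ - a₂ + a₂) = γ₂ b₂
      rw [sub_add_cancel]
    · intro s hs
      rw [CausalCurveGluing.glueAt_of_le hs.2]
      show γ₁ (b₁ + c * s) = γ₁ (c * s + b₁)
      rw [add_comm]
    · intro s hs
      rw [CausalCurveGluing.glueAt_of_lt hs.1, CausalCurveGluing.glueAt_of_lt hs.1]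
  · /- **Non-proportional velocities**: their sum is future timelike; round the corner in the
    chart. -/
    have hne : ¬ ∃ c : ℝ, 0 < c ∧ ψ (u₂ 0) = c • ψ (u₁ 0) := by
      rintro ⟨c, hc, hcψ⟩
      refine hpar ⟨c, hc, ?_⟩
      have hb : φ.symm x₀ ∈ (trivializationAt E (TangentSpace I) p).baseSet := by
        rw [hx₀p]; simp
      have h1 := congrArg ((trivializationAt E (TangentSpace I) p).continuousLinearMapAt ℝ
        (φ.symm x₀)) hcψ
      rwa [map_smul, hψ, Trivialization.continuousLinearMapAt_symmL _ hb,
        Trivialization.continuousLinearMapAt_symmL _ hb] at h1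
    have hDt : g.IsTimelike (ψ (u₁ 0) + ψ (u₂ 0)) := hw₁.isTimelike_add hw₂ hne
    have hDf : τ.IsFutureDirected (ψ (u₁ 0) + ψ (u₂ 0)) := hw₁.add τ hw₂
    rw [← map_add] at hDt hDf
    have hD : G x₀ (u₁ 0 + u₂ 0) (u₁ 0 + u₂ 0) < 0 := (isTimelike_symmL_iff (g := g) hx₀t _).mp hDt
    have hTD : G x₀ (Tc x₀) (u₁ 0 + u₂ 0) < 0 :=
      ((isFutureDirected_symmL_iff (τ := τ) hx₀t _).mp hDf).2
    -- round the corner in coordinates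
    obtain ⟨ε, s₄, hε0, hεη, hεδ₀, hεs₄, ĉ, û, hgood, hleftc, hrightc⟩ :=
      CausalCurveGluing.corner_rounding_coord (ε₁ := η) hR hδ₀ hη hGd hTc hsymm hcone hc₁ hc₂
        h₁0 h₂0 hD hTD
    -- the middle piece is a causal curve
    have hm : g.IsFutureCausalCurveOn τ (φ.symm ∘ ĉ) (Icc (-ε) s₄) :=
      isFutureCausalCurveOn_extChartAt_symm_comp (U := Metric.ball x₀ R) Metric.isOpen_ball hballR
        fun s hs ↦ by
          obtain ⟨hd, hb, hcs⟩ := hgood s hs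
          exact ⟨hd, by rwa [Metric.mem_ball, dist_eq_norm], hcs⟩
    -- the reparametrised second curve
    have hγ₂' : g.IsFutureCausalCurveOn τ (fun s ↦ γ₂ (s + (a₂ + ε - s₄)))
        (Icc s₄ (s₄ + (b₂ - a₂ - ε))) := by
      refine (hγ₂.comp_add_const (a₂ + ε - s₄)).mono (Icc_subset_Icc (by linarith) (by linarith))
    -- glue
    have hΓ := IsFutureCausalCurveOn.glue (σ₀ := -ε) (σ₁ := s₄) hεs₄.le hδ₀
      (hγ₁'.mono (Icc_subset_Icc le_rfl (by linarith))) hm hγ₂'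
      (fun s hs ↦ by
        have hsN : |s| < 2 * δ₀ := by rw [abs_lt]; constructor <;> linarith [hs.1, hs.2]
        show φ.symm (ĉ s) = γ₁ (s + b₁)
        rw [hleftc s hs.2]
        exact (extChartAt I p).left_inv (hγ₁N s hsN).1)
      (fun s hs ↦ by
        have hsN : |s - s₄ + ε| < 2 * δ₀ := by
          rw [abs_lt]; constructor <;> linarith [hs.1, hs.2]
        show φ.symm (ĉ s) = γ₂ (s + (a₂ + ε - s₄))
        rw [hrightc s hs.1.le, show s + (a₂ + ε - s₄) = (s - s₄ + ε) + a₂ by ring]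
        exact (extChartAt I p).left_inv (hγ₂N _ hsN).1)
    refine ⟨_, a₁ - b₁, s₄ + (b₂ - a₂ - ε), -ε, s₄, a₂ + ε - s₄, 1, by linarith, hΓ, ?_, ?_,
      by linarith, hεs₄.le, by linarith, one_pos, by ring, by linarith, ?_, by ring, by linarith,
      ?_⟩
    · rw [CausalCurveGluing.glueAt_of_le (by linarith)]
      show γ₁ (a₁ - b₁ + b₁) = γ₁ a₁
      rw [sub_add_cancel]
    · rw [CausalCurveGluing.glueAt_of_lt (by linarith),
        CausalCurveGluing.glueAt_of_lt (by linarith)]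
      show γ₂ (s₄ + (b₂ - a₂ - ε) + (a₂ + ε - s₄)) = γ₂ b₂
      congr 1; ring
    · intro s hs
      rw [CausalCurveGluing.glueAt_of_le hs.2]
      show γ₁ (s + b₁) = γ₁ (1 * s + b₁)
      rw [one_mul]
    · intro s hs
      rw [CausalCurveGluing.glueAt_of_lt (show -ε < s by linarith [hs.1]),
        CausalCurveGluing.glueAt_of_lt hs.1]


end LorentzianMetric

/-! ### Arc length under affine reparametrisation; exhaustion at the right end -/

namespace PseudoRiemannianMetric

variable {g : PseudoRiemannianMetric I n E (TangentSpace I : M → Type _)}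

/-- The speed of `t ↦ γ (k t)` at `s` is `k` times the speed of `γ` at `k s` (`k > 0`).
O'Neill 1983, Ch. 5, Lemma 5.12. [folklore] -/
lemma speed_comp_mul (γ : ℝ → M) {k : ℝ} (hk : 0 < k) (s : ℝ) :
    g.speed (fun t ↦ γ (k * t)) s = k * g.speed γ (k * s) := by
  have hv : velocity I (fun t ↦ γ (k * t)) s = k • velocity I γ (k * s) := by
    have h := velocity_comp_affine (I := I) γ k 0 s
    have h1 : (fun t : ℝ ↦ γ (k * t + 0)) = fun t ↦ γ (k * t) := by
      funext t; rw [add_zero]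
    rw [h1, add_zero] at h
    exact h
  simp only [speed_def]
  rw [hv, map_smul, map_smul, smul_apply, smul_eq_mul, smul_eq_mul, ← mul_assoc, abs_mul,
    abs_mul_self, Real.sqrt_mul (mul_self_nonneg k), Real.sqrt_mul_self hk.le]

/-- **Arc length under a linear change of parameter**: `L(γ (k ·)|[a, b]) = L(γ|[k a, k b])` for
`k > 0` (change of variables `u = k t` in the lower Lebesgue integral; no measurability of the
speed is needed, `MeasurableEmbedding.lintegral_map`). O'Neill 1983, Ch. 5, Lemma 5.12.
[folklore] -/
lemma arcLength_comp_mul (γ : ℝ → M) {k : ℝ} (hk : 0 < k) (a b : ℝ) :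
    g.arcLength (fun t ↦ γ (k * t)) a b = g.arcLength γ (k * a) (k * b) := by
  simp only [arcLength_eq_lintegral_Icc]
  rcases le_or_gt a b with hab | hab
  · have h1 : ∫⁻ t in Icc a b, ENNReal.ofReal (g.speed (fun t ↦ γ (k * t)) t) =
        ENNReal.ofReal k * ∫⁻ t in Icc a b, ENNReal.ofReal (g.speed γ (k * t)) := by
      rw [← lintegral_const_mul' _ _ ENNReal.ofReal_ne_top]
      refine setLIntegral_congr_fun measurableSet_Icc fun t _ ↦ ?_
      rw [speed_comp_mul γ hk t, ENNReal.ofReal_mul hk.le]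
    have h2 : ∫⁻ t in Icc a b, ENNReal.ofReal (g.speed γ (k * t)) =
        ENNReal.ofReal k⁻¹ * ∫⁻ u in Icc (k * a) (k * b), ENNReal.ofReal (g.speed γ u) := by
      rw [← lintegral_indicator measurableSet_Icc, ← lintegral_indicator measurableSet_Icc]
      have hind : (fun t ↦ (Icc a b).indicator (fun t ↦ ENNReal.ofReal (g.speed γ (k * t))) t) =
          fun t ↦ (Icc (k * a) (k * b)).indicator (fun u ↦ ENNReal.ofReal (g.speed γ u))
            (k * t) := by
        funext t
        by_cases ht : t ∈ Icc a b
        · have ht' : k * t ∈ Icc (k * a) (k * b) :=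
            ⟨mul_le_mul_of_nonneg_left ht.1 hk.le, mul_le_mul_of_nonneg_left ht.2 hk.le⟩
          rw [indicator_of_mem ht, indicator_of_mem ht']
        · have ht' : k * t ∉ Icc (k * a) (k * b) := fun h ↦
            ht ⟨le_of_mul_le_mul_left h.1 hk, le_of_mul_le_mul_left h.2 hk⟩
          rw [indicator_of_notMem ht, indicator_of_notMem ht']
      rw [hind, ← (measurableEmbedding_mulLeft₀ hk.ne').lintegral_map,
        Real.map_volume_mul_left hk.ne', lintegral_smul_measure, abs_of_pos (inv_pos.2 hk),
        smul_eq_mul]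
    rw [h1, h2, ← mul_assoc, ← ENNReal.ofReal_mul hk.le, mul_inv_cancel₀ hk.ne',
      ENNReal.ofReal_one, one_mul]
  · rw [Icc_eq_empty_of_lt hab, Icc_eq_empty_of_lt (mul_lt_mul_of_pos_left hab hk),
      Measure.restrict_empty, lintegral_zero_measure, lintegral_zero_measure]

/-- **Arc length under an affine change of parameter**: `L(γ (k · + c)|[a, b]) =
L(γ|[k a + c, k b + c])` for `k > 0`. O'Neill 1983, Ch. 5, Lemma 5.12. [folklore] -/
lemma arcLength_comp_mul_add (γ : ℝ → M) {k : ℝ} (hk : 0 < k) (c a b : ℝ) :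
    g.arcLength (fun t ↦ γ (k * t + c)) a b = g.arcLength γ (k * a + c) (k * b + c) := by
  have h1 := arcLength_comp_mul (g := g) (fun u ↦ γ (u + c)) hk a b
  have h2 := arcLength_comp_add_const (g := g) γ c (k * a) (k * b)
  exact h1.trans h2

/-- **Exhaustion of the arc length from the inside at the right end**: if `L(γ|[a, b']) ≤ C` for
all `b'` with `a < b' < b`, then `L(γ|[a, b]) ≤ C` (the integral over `[a, b)` is the supremum of
the integrals over `[a, b']`, `b' ↑ b`; no measurability is needed). [folklore] -/
lemma arcLength_le_of_forall_gt {γ : ℝ → M} {a b : ℝ} (hab : a < b) {C : ℝ≥0∞}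
    (h : ∀ b', a < b' → b' < b → g.arcLength γ a b' ≤ C) : g.arcLength γ a b ≤ C := by
  -- `Ico a b` as the increasing union of `Icc a (b - δ k)`, `δ k = (b - a) / (k + 2)`
  let δ : ℕ → ℝ := fun k : ℕ ↦ (b - a) / ((k : ℝ) + 2)
  have hδ : δ = fun k : ℕ ↦ (b - a) / ((k : ℝ) + 2) := rfl
  have hδpos : ∀ k, 0 < δ k := fun k ↦ by rw [hδ]; positivity
  have hδlt : ∀ k, δ k < b - a := fun k ↦ by
    rw [hδ, div_lt_iff₀ (by positivity)]; nlinarith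
  have hδanti : ∀ k l : ℕ, k ≤ l → δ l ≤ δ k := fun k l hkl ↦ by
    simp only [hδ]
    exact div_le_div_of_nonneg_left (by linarith) (by positivity)
      (by exact_mod_cast Nat.add_le_add_right hkl 2)
  have hU : (⋃ k : ℕ, Icc a (b - δ k)) = Ico a b := by
    ext x
    simp only [mem_iUnion, mem_Icc, mem_Ico]
    constructor
    · rintro ⟨k, h1, h2⟩
      exact ⟨h1, by linarith [hδpos k]⟩
    · rintro ⟨h1, h2⟩
      obtain ⟨k, hk⟩ := exists_nat_gt ((b - a) / (b - x))
      refine ⟨k, h1, ?_⟩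
      have hxb : 0 < b - x := by linarith
      have hk' : (b - a) / (b - x) < (k : ℝ) + 2 := by linarith
      rw [div_lt_iff₀ hxb] at hk'
      have : δ k < b - x := by
        rw [hδ, div_lt_iff₀ (by positivity)]; linarith
      linarith
  have hdir : Directed (· ⊆ ·) fun k : ℕ ↦ Icc a (b - δ k) :=
    Monotone.directed_le fun k l hkl ↦ Icc_subset_Icc le_rfl (by linarith [hδanti k l hkl])
  have key : g.arcLength γ a b = ⨆ k : ℕ, g.arcLength γ a (b - δ k) := by
    simp only [arcLength_eq_lintegral_Icc]
    rw [← restrict_Ico_eq_restrict_Icc, ← hU]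
    exact setLIntegral_iUnion_of_directed _ hdir
  rw [key]
  exact iSup_le fun k ↦ h _ (by linarith [hδlt k]) (by linarith [hδpos k])

end PseudoRiemannianMetric

/-! ### The reverse triangle inequality -/

namespace LorentzianMetric

variable {g : LorentzianMetric I n M} {τ : TimeOrientation g}

/-- **Reverse triangle inequality, segment form**: for consecutive future causal segments
`γ₁ : [a₁, b₁] → M` and `γ₂ : [a₂, b₂] → M` with `γ₁ b₁ = γ₂ a₂` one has
`L(γ₁) + L(γ₂) ≤ τ(γ₁ a₁, γ₂ b₂)`: glue with rounded corner keeping `γ₁|[a₁, b₁ - η₁]` (affinely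
reparametrised) and `γ₂|[a₂ + η₂, b₂]` (`exists_isFutureCausalCurveOn_trans_head_tail` with
`η = min η₁ η₂`), so that `L(γ₁|[a₁, b₁ - η₁]) + L(γ₂|[a₂ + η₂, b₂]) ≤ τ`, and let `η₁, η₂ → 0`
(`arcLength_le_of_forall_gt`, `arcLength_le_of_forall_lt`). O'Neill 1983, Ch. 14,
Lemma 14.16 (2) (p. 409): "`τ(p, r) ≥ L(α + β)`".
[cite: ONeillSemiRiemannian1983, Ch. 14, Lemma 14.16 (2) (p. 409)] -/
theorem arcLength_add_arcLength_le_lorentzDist [BoundarylessManifold I M] (hn : 1 ≤ n)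
    {γ₁ γ₂ : ℝ → M} {a₁ b₁ a₂ b₂ : ℝ} (hab₁ : a₁ < b₁) (hab₂ : a₂ < b₂)
    (hγ₁ : g.IsFutureCausalCurveOn τ γ₁ (Icc a₁ b₁))
    (hγ₂ : g.IsFutureCausalCurveOn τ γ₂ (Icc a₂ b₂))
    (hjoin : γ₁ b₁ = γ₂ a₂) :
    g.arcLength γ₁ a₁ b₁ + g.arcLength γ₂ a₂ b₂ ≤ g.lorentzDist τ (γ₁ a₁) (γ₂ b₂) := by
  -- the truncated inequality
  have htrunc : ∀ η₁ η₂ : ℝ, 0 < η₁ → 0 < η₂ →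
      g.arcLength γ₁ a₁ (b₁ - η₁) + g.arcLength γ₂ (a₂ + η₂) b₂ ≤
        g.lorentzDist τ (γ₁ a₁) (γ₂ b₂) := by
    intro η₁ η₂ hη₁ hη₂
    obtain ⟨Γ, a, b, s₁, s₀, c, k, hab, hΓ, hΓa, hΓb, has₁, hs₁s₀, hs₀b, hk, hka, hks₁, hhead,
      hbc, hs₀c, htail⟩ :=
      exists_isFutureCausalCurveOn_trans_head_tail hn hab₁ hab₂ hγ₁ hγ₂ hjoin (η := min η₁ η₂)
        (lt_min hη₁ hη₂)
    have hmin₁ : min η₁ η₂ ≤ η₁ := min_le_left _ _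
    have hmin₂ : min η₁ η₂ ≤ η₂ := min_le_right _ _
    -- head: `L(γ₁|[a₁, b₁ - η₁]) ≤ L(Γ|[a, s₁])`
    have h1 : g.arcLength γ₁ a₁ (b₁ - η₁) ≤ g.arcLength Γ a s₁ := by
      calc g.arcLength γ₁ a₁ (b₁ - η₁)
          ≤ g.arcLength γ₁ (k * a + b₁) (k * s₁ + b₁) :=
            PseudoRiemannianMetric.arcLength_mono γ₁ (by rw [hka]) (by linarith)
        _ = g.arcLength (fun t ↦ γ₁ (k * t + b₁)) a s₁ :=
            (PseudoRiemannianMetric.arcLength_comp_mul_add γ₁ hk b₁ a s₁).symm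
        _ = g.arcLength Γ a s₁ :=
            PseudoRiemannianMetric.arcLength_congr fun s hs ↦ (hhead s hs).symm
    -- tail: `L(γ₂|[a₂ + η₂, b₂]) ≤ L(Γ|[s₀, b])`
    have h2 : g.arcLength γ₂ (a₂ + η₂) b₂ ≤ g.arcLength Γ s₀ b := by
      calc g.arcLength γ₂ (a₂ + η₂) b₂
          ≤ g.arcLength γ₂ (s₀ + c) (b + c) :=
            PseudoRiemannianMetric.arcLength_mono γ₂ (by linarith) (by linarith)
        _ = g.arcLength (fun t ↦ γ₂ (t + c)) s₀ b :=
            (PseudoRiemannianMetric.arcLength_comp_add_const γ₂ c s₀ b).symm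
        _ = g.arcLength Γ s₀ b :=
            PseudoRiemannianMetric.arcLength_congr_Ioo fun s hs ↦ (htail s ⟨hs.1, hs.2.le⟩).symm
    -- the two pieces of `Γ` are disjoint in parameter
    have h3 : g.arcLength Γ a s₁ + g.arcLength Γ s₀ b ≤ g.arcLength Γ a b := by
      calc g.arcLength Γ a s₁ + g.arcLength Γ s₀ b
          ≤ g.arcLength Γ a s₁ + g.arcLength Γ s₁ b :=
            add_le_add le_rfl (PseudoRiemannianMetric.arcLength_mono Γ hs₁s₀ le_rfl)
        _ = g.arcLength Γ a b :=
            PseudoRiemannianMetric.arcLength_add (g := g.toPseudoRiemannianMetric) Γ has₁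
              (hs₁s₀.trans hs₀b.le)
    calc g.arcLength γ₁ a₁ (b₁ - η₁) + g.arcLength γ₂ (a₂ + η₂) b₂
        ≤ g.arcLength Γ a s₁ + g.arcLength Γ s₀ b := add_le_add h1 h2
      _ ≤ g.arcLength Γ a b := h3
      _ ≤ g.lorentzDist τ (γ₁ a₁) (γ₂ b₂) := by
          rw [← hΓa, ← hΓb]
          exact arcLength_le_lorentzDist hab hΓ rfl rfl
  -- let `η₂ → 0`, then `η₁ → 0` (if `τ = ∞` there is nothing to prove)
  let T := g.lorentzDist τ (γ₁ a₁) (γ₂ b₂)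
  rcases eq_or_ne T ⊤ with hT | hT
  · exact le_of_le_of_eq le_top hT.symm
  have hstep : ∀ η₁ : ℝ, 0 < η₁ →
      g.arcLength γ₁ a₁ (b₁ - η₁) + g.arcLength γ₂ a₂ b₂ ≤ T := by
    intro η₁ hη₁
    have hL1 : g.arcLength γ₁ a₁ (b₁ - η₁) ≤ T := by
      have h := htrunc η₁ 1 hη₁ one_pos
      exact le_trans (self_le_add_right _ _) h
    have hL1f : g.arcLength γ₁ a₁ (b₁ - η₁) ≠ ⊤ := ne_top_of_le_ne_top hT hL1
    have hL2 : g.arcLength γ₂ a₂ b₂ ≤ T - g.arcLength γ₁ a₁ (b₁ - η₁) := by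
      refine PseudoRiemannianMetric.arcLength_le_of_forall_lt hab₂ fun a' ha' _ ↦ ?_
      have h := htrunc η₁ (a' - a₂) hη₁ (by linarith)
      rw [add_sub_cancel] at h
      exact ENNReal.le_sub_of_add_le_left hL1f h
    calc g.arcLength γ₁ a₁ (b₁ - η₁) + g.arcLength γ₂ a₂ b₂
        ≤ g.arcLength γ₁ a₁ (b₁ - η₁) + (T - g.arcLength γ₁ a₁ (b₁ - η₁)) :=
          add_le_add le_rfl hL2
      _ = T := add_tsub_cancel_of_le hL1
  have hL2' : g.arcLength γ₂ a₂ b₂ ≤ T :=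
    le_trans (self_le_add_left _ _) (hstep 1 one_pos)
  have hL2f : g.arcLength γ₂ a₂ b₂ ≠ ⊤ := ne_top_of_le_ne_top hT hL2'
  have hL1' : g.arcLength γ₁ a₁ b₁ ≤ T - g.arcLength γ₂ a₂ b₂ := by
    refine PseudoRiemannianMetric.arcLength_le_of_forall_gt hab₁ fun b' _ hb' ↦ ?_
    have h := hstep (b₁ - b') (by linarith)
    rw [sub_sub_cancel] at h
    exact ENNReal.le_sub_of_add_le_right hL2f h
  calc g.arcLength γ₁ a₁ b₁ + g.arcLength γ₂ a₂ b₂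
      ≤ (T - g.arcLength γ₂ a₂ b₂) + g.arcLength γ₂ a₂ b₂ := add_le_add hL1' le_rfl
    _ = T := tsub_add_cancel_of_le hL2'

/-- **Reverse triangle inequality, mixed form**: for a future causal segment `γ : [a, b] → M`
from `p` to `q` and `r ∈ J⁺(q)`, `L(γ) + τ(q, r) ≤ τ(p, r)`. O'Neill 1983, Ch. 14,
Lemma 14.16 (2) (p. 409). [cite: ONeillSemiRiemannian1983, Ch. 14, Lemma 14.16 (2) (p. 409)] -/
theorem arcLength_add_lorentzDist_le [BoundarylessManifold I M] (hn : 1 ≤ n)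
    {γ : ℝ → M} {a b : ℝ} {r : M} (hab : a < b) (hγ : g.IsFutureCausalCurveOn τ γ (Icc a b))
    (hr : r ∈ g.causalFuture τ {γ b}) :
    g.arcLength γ a b + g.lorentzDist τ (γ b) r ≤ g.lorentzDist τ (γ a) r := by
  -- `L(γ) ≤ τ(p, r)`
  have h1 : g.arcLength γ a b ≤ g.lorentzDist τ (γ a) r := by
    rcases hr with hrq | ⟨q₀, hq₀, β, a₂, b₂, hab₂, hβ, hβa, hβb⟩
    · rw [mem_singleton_iff] at hrq
      rw [hrq]
      exact arcLength_le_lorentzDist hab hγ rfl rfl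
    · rw [mem_singleton_iff] at hq₀
      have h := arcLength_add_arcLength_le_lorentzDist hn hab hab₂ hγ hβ (hβa.trans hq₀).symm
      rw [hβb] at h
      exact le_trans (self_le_add_right _ _) h
  -- `τ(q, r) ≤ τ(p, r) - L(γ)` (if `τ(p, r) = ∞` there is nothing to prove)
  rcases eq_or_ne (g.lorentzDist τ (γ a) r) ⊤ with hT | hT
  · rw [hT]; exact le_top
  have h1f : g.arcLength γ a b ≠ ⊤ := ne_top_of_le_ne_top hT h1
  have h2 : g.lorentzDist τ (γ b) r ≤ g.lorentzDist τ (γ a) r - g.arcLength γ a b := by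
    refine lorentzDist_le_iff.2 fun β a₂ b₂ hab₂ hβ hβa hβb ↦ ?_
    have h := arcLength_add_arcLength_le_lorentzDist hn hab hab₂ hγ hβ hβa.symm
    rw [hβb] at h
    exact ENNReal.le_sub_of_add_le_left h1f h
  calc g.arcLength γ a b + g.lorentzDist τ (γ b) r
      ≤ g.arcLength γ a b + (g.lorentzDist τ (γ a) r - g.arcLength γ a b) := add_le_add le_rfl h2
    _ = g.lorentzDist τ (γ a) r := add_tsub_cancel_of_le h1

/-- **Reverse triangle inequality** (O'Neill 1983, Ch. 14, Lemma 14.16 (2), p. 409): if `p ≤ q ≤ r`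
(`q ∈ J⁺(p)`, `r ∈ J⁺(q)`) then `τ(p, q) + τ(q, r) ≤ τ(p, r)`, for the time separation of the
tree's everywhere-differentiable causal curves.
[cite: ONeillSemiRiemannian1983, Ch. 14, Lemma 14.16 (2) (p. 409)] -/
theorem lorentzDist_add_lorentzDist_le [BoundarylessManifold I M] (hn : 1 ≤ n) {p q r : M}
    (hq : q ∈ g.causalFuture τ {p}) (hr : r ∈ g.causalFuture τ {q}) :
    g.lorentzDist τ p q + g.lorentzDist τ q r ≤ g.lorentzDist τ p r := by
  have h1 : g.lorentzDist τ q r ≤ g.lorentzDist τ p r :=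
    lorentzDist_le_lorentzDist_of_mem_causalFuture hn hq r
  rcases eq_or_ne (g.lorentzDist τ p r) ⊤ with hT | hT
  · rw [hT]; exact le_top
  have h1f : g.lorentzDist τ q r ≠ ⊤ := ne_top_of_le_ne_top hT h1
  have h2 : g.lorentzDist τ p q ≤ g.lorentzDist τ p r - g.lorentzDist τ q r := by
    refine lorentzDist_le_iff.2 fun γ a b hab hγ hγa hγb ↦ ?_
    have h := arcLength_add_lorentzDist_le hn hab hγ (hγb.symm ▸ hr)
    rw [hγa, hγb] at h
    exact ENNReal.le_sub_of_add_le_right h1f h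
  calc g.lorentzDist τ p q + g.lorentzDist τ q r
      ≤ (g.lorentzDist τ p r - g.lorentzDist τ q r) + g.lorentzDist τ q r := add_le_add h2 le_rfl
    _ = g.lorentzDist τ p r := tsub_add_cancel_of_le h1

end LorentzianMetric

end Literature.Geometry.Lorentzian

end
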